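import Mathlib.Algebra.Polynomial.Laurent
import Mathlib.Algebra.Polynomial.Degree.Support
import HarnessLib

/-!
# `ℤ`-gradings as Laurent coactions (crux `FInjectiveMacaulayfication`, line `graded-engine`, helper H-G1/H-G2)

Support file for crux stmt-ResolutionOfSingularities-15315 (`FrobeniusLadder.FInjectiveMacaulayfication`,
registered skeleton v11 `86e9127b`, line `graded-engine`, §16 G4 `stub_gradedChartClause`). [OURS · L1 W4.5a]

The G4 assembly (lead res-L1-w45a-lead-1, `GRADED-ENGINE.md` v2) needs the `ℤ`-grading by weight on the
localization `L = (k[X]/(f))[1/x̄_v^c]` of a weighted-homogeneous hypersurface ring (helper H-G1) and, built on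
it, the degree-`0` / Veronese subalgebras of the extended Rees algebra `L[s]` (helper H-G2). Mathlib has no
grading on a localization of a quotient, so we encode a `ℤ`-grading of a commutative ring `L` WITHOUT any
`GradedRing` structure, as a **coaction of `𝔾ₘ`**: a ring map `β : L →+* L[T;T⁻¹]` (think `ℓ ↦ Σᵢ ℓᵢ Tⁱ`).
An element `ℓ` is *homogeneous of degree `d`* iff `β ℓ = single d ℓ`; its *components* are the coefficients
`(β ℓ).coeff i`. This file is the abstract calculus:

* algebra of homogeneous elements (`hom_add`, `hom_mul`, `hom_pow`, `hom_sum`, `hom_of_mul_eq_one`), coefficient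
  extraction from sums of homogeneous elements of distinct degrees (`coeff_sum_hom`, uniqueness / independence);
* COUNIT `ε ∘ β = id` (`ε` = Laurent evaluation at `T = 1`) gives the decomposition `ℓ = Σᵢ (β ℓ)ᵢ`
  (`sum_coeff_eq`) and injectivity of `β`;
* COASSOCIATIVITY in the form "components are homogeneous", `β ((β ℓ)ᵢ) = single i ((β ℓ)ᵢ)`;
* `counit_of_ext` / `coassoc_of_ext`: both identities hold as soon as ring maps out of `L` are determined by
  their values on `k` and on a set `G` of homogeneous generators (they are equalities of ring maps
  `L → L`, resp. `L → L[T;T⁻¹][T;T⁻¹]`, checked on generators) — this is how the concrete coaction on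
  `(k[X]/(f))[1/x̄_v^c]` (sequel file) gets them for free.

Everything is folklore (SGA 3 I.4.7.3: `ℤ`-gradings = `𝔾ₘ`-actions = comodule structures over `k[T,T⁻¹]`);
no definitions are declared (hypotheses `hε`, `hΔ` are carried explicitly), no named facts.
-/

-- single-problem summit: the doubled namespace component is forced
set_option linter.dupNamespace false

noncomputable section

open scoped LaurentPolynomial Polynomial
open AddMonoidAlgebra LaurentPolynomial

namespace Summit.ResolutionOfSingularities.ResolutionOfSingularities.Theorems.FInjectiveMacaulayfication.LaurentCoaction

variable {L : Type} [CommRing L]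

/-! ## Coefficients of Laurent polynomials -/

/-- `(single d a).coeff i = if d = i then a else 0`. [folklore] -/
theorem single_coeff_apply (d i : ℤ) (a : L) :
    (single d a : L[T;T⁻¹]).coeff i = if d = i then a else 0 := by
  rw [coeff_single, Finsupp.single_apply]

/-- Coefficient extraction from a sum of monomials with distinct exponents. [folklore] -/
theorem coeff_sum_single {ι : Type*} (s : Finset ι) (g : ι → L) (d : ι → ℤ) (hd : Set.InjOn d s)
    (i : ι) (hi : i ∈ s) :
    (∑ j ∈ s, (single (d j) (g j) : L[T;T⁻¹])).coeff (d i) = g i := by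
  classical
  rw [coeff_sum, Finsupp.finsetSum_apply, Finset.sum_eq_single i]
  · rw [single_coeff_apply, if_pos rfl]
  · intro j hj hji
    rw [single_coeff_apply, if_neg]
    exact fun h => hji (hd hj hi h)
  · exact fun h => (h hi).elim

/-- A sum of monomials with distinct exponents has no coefficient outside those exponents. [folklore] -/
theorem coeff_sum_single_of_notMem {ι : Type*} (s : Finset ι) (g : ι → L) (d : ι → ℤ) (e : ℤ)
    (he : ∀ j ∈ s, d j ≠ e) :
    (∑ j ∈ s, (single (d j) (g j) : L[T;T⁻¹])).coeff e = 0 := by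
  classical
  rw [coeff_sum, Finsupp.finsetSum_apply]
  refine Finset.sum_eq_zero fun j hj => ?_
  rw [single_coeff_apply, if_neg (he j hj)]

/-- Laurent evaluation at `T = 1` (coefficients read in `L` itself) is the sum of the coefficients. [folklore] -/
theorem eval₂_one_eq_sum (P : L[T;T⁻¹]) :
    LaurentPolynomial.eval₂ (RingHom.id L) 1 P = ∑ i ∈ P.coeff.support, P.coeff i := by
  conv_lhs => rw [← sum_coeff_single P]
  rw [Finsupp.sum, map_sum]
  refine Finset.sum_congr rfl fun i _ => ?_
  rw [single_eq_C_mul_T, eval₂_C_mul_T, one_zpow, Units.val_one, mul_one, RingHom.id_apply]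

/-- The coefficients of `toLaurent q` in non-negative degrees are those of `q`. [folklore] -/
theorem toLaurent_coeff_natCast (q : L[X]) (m : ℕ) : (Polynomial.toLaurent q).coeff (m : ℤ) = q.coeff m := by
  classical
  conv_lhs => rw [q.as_sum_support, map_sum]
  simp only [Polynomial.toLaurent_C_mul_T, ← single_eq_C_mul_T]
  by_cases hm : m ∈ q.support
  · exact coeff_sum_single q.support (fun j => q.coeff j) (fun j : ℕ => (j : ℤ))
      (fun a _ b _ h => by beta_reduce at h; exact_mod_cast h) m hm
  · rw [coeff_sum_single_of_notMem, Polynomial.notMem_support_iff.mp hm]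
    intro j hj h
    have hjm : j = m := by exact_mod_cast h
    exact hm (hjm ▸ hj)

/-- `toLaurent q` has no coefficients in negative degrees. [folklore] -/
theorem toLaurent_coeff_eq_zero_of_neg (q : L[X]) (e : ℤ) (he : e < 0) : (Polynomial.toLaurent q).coeff e = 0 := by
  classical
  conv_lhs => rw [q.as_sum_support, map_sum]
  simp only [Polynomial.toLaurent_C_mul_T, ← single_eq_C_mul_T]
  refine coeff_sum_single_of_notMem _ _ _ _ fun j _ h => ?_
  omega

/-- `toLaurent q = Σₘ single m (q.coeff m)`. [folklore] -/
theorem toLaurent_eq_sum (q : L[X]) :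
    Polynomial.toLaurent q = ∑ m ∈ q.support, single (m : ℤ) (q.coeff m) := by
  conv_lhs => rw [q.as_sum_support, map_sum]
  simp only [Polynomial.toLaurent_C_mul_T, ← single_eq_C_mul_T]

/-! ## Homogeneous elements of a coaction `β : L → L[T;T⁻¹]` -/

section Hom

variable {β : L →+* L[T;T⁻¹]}

/-- `0` is homogeneous of every degree. [folklore] -/
theorem hom_zero (β : L →+* L[T;T⁻¹]) (d : ℤ) : β 0 = single d 0 := by
  rw [map_zero, single_zero]

/-- `1` is homogeneous of degree `0`. [folklore] -/
theorem hom_one (β : L →+* L[T;T⁻¹]) : β 1 = single 0 1 := by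
  rw [map_one, one_def]

/-- Sums of homogeneous elements of the same degree are homogeneous. [folklore] -/
theorem hom_add {d : ℤ} {a b : L} (ha : β a = single d a) (hb : β b = single d b) :
    β (a + b) = single d (a + b) := by
  rw [map_add, ha, hb, single_add]

/-- Negatives of homogeneous elements are homogeneous. [folklore] -/
theorem hom_neg {d : ℤ} {a : L} (ha : β a = single d a) : β (-a) = single d (-a) := by
  rw [map_neg, ha, single_neg]

/-- Finite sums of homogeneous elements of one degree are homogeneous. [folklore] -/
theorem hom_sum {ι : Type*} (s : Finset ι) (g : ι → L) (d : ℤ)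
    (h : ∀ i ∈ s, β (g i) = single d (g i)) : β (∑ i ∈ s, g i) = single d (∑ i ∈ s, g i) := by
  classical
  induction s using Finset.induction_on with
  | empty => rw [Finset.sum_empty, map_zero, single_zero]
  | insert i s hi ih =>
    rw [Finset.sum_insert hi, map_add, h i (Finset.mem_insert_self _ _),
      ih (fun j hj => h j (Finset.mem_insert_of_mem hj)), single_add]

/-- Products of homogeneous elements are homogeneous, degrees add. [folklore] -/
theorem hom_mul {d e : ℤ} {a b : L} (ha : β a = single d a) (hb : β b = single e b) :
    β (a * b) = single (d + e) (a * b) := by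
  rw [map_mul, ha, hb, single_mul_single]

/-- Powers of a homogeneous element. [folklore] -/
theorem hom_pow {d : ℤ} {a : L} (ha : β a = single d a) (m : ℕ) :
    β (a ^ m) = single ((m : ℤ) * d) (a ^ m) := by
  induction m with
  | zero => rw [pow_zero, Nat.cast_zero, zero_mul, map_one, one_def]
  | succ m ih => rw [pow_succ, map_mul, ih, ha, single_mul_single, Nat.cast_succ, add_mul, one_mul]

/-- The inverse of a homogeneous unit is homogeneous of the opposite degree. [folklore] -/
theorem hom_of_mul_eq_one {d : ℤ} {a b : L} (hab : a * b = 1) (ha : β a = single d a) :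
    β b = single (-d) b := by
  have h1 : β a * β b = 1 := by rw [← map_mul, hab, map_one]
  calc β b = β b * (single d a * single (-d) b) := by
          rw [single_mul_single, add_neg_cancel, hab, ← one_def, mul_one]
    _ = β a * β b * single (-d) b := by rw [ha]; ring
    _ = single (-d) b := by rw [h1, one_mul]

/-- The components of a homogeneous element: itself in its degree, `0` elsewhere. [folklore] -/
theorem coeff_of_hom {d : ℤ} {a : L} (ha : β a = single d a) (i : ℤ) :
    (β a).coeff i = if d = i then a else 0 := by
  rw [ha, single_coeff_apply]

/-- **Uniqueness of homogeneous decompositions**: in a sum of homogeneous elements of distinct degrees, the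
component of degree `d i` is the `i`-th summand. [folklore] -/
theorem coeff_sum_hom {ι : Type*} (s : Finset ι) (g : ι → L) (d : ι → ℤ) (hd : Set.InjOn d s)
    (hg : ∀ j ∈ s, β (g j) = single (d j) (g j)) (i : ι) (hi : i ∈ s) :
    (β (∑ j ∈ s, g j)).coeff (d i) = g i := by
  rw [map_sum, Finset.sum_congr rfl hg]
  exact coeff_sum_single s g d hd i hi

/-- **Independence of homogeneous elements of distinct degrees**: if they sum to zero they all vanish. [folklore] -/
theorem eq_zero_of_sum_hom_eq_zero {ι : Type*} (s : Finset ι) (g : ι → L) (d : ι → ℤ) (hd : Set.InjOn d s)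
    (hg : ∀ j ∈ s, β (g j) = single (d j) (g j)) (h0 : ∑ j ∈ s, g j = 0) (i : ι) (hi : i ∈ s) :
    g i = 0 := by
  have h := coeff_sum_hom s g d hd hg i hi
  rw [h0, map_zero] at h
  exact h.symm

/-- A homogeneous element which is also a sum of homogeneous elements of distinct degrees equals the summand of
its own degree. [folklore] -/
theorem eq_of_hom_of_eq_sum_hom {ι : Type*} (s : Finset ι) (g : ι → L) (d : ι → ℤ) (hd : Set.InjOn d s)
    (hg : ∀ j ∈ s, β (g j) = single (d j) (g j)) {x : L} (hx : x = ∑ j ∈ s, g j) (i : ι) (hi : i ∈ s)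
    (hxi : β x = single (d i) x) : x = g i := by
  have h := coeff_sum_hom s g d hd hg i hi
  rw [← hx, coeff_of_hom hxi, if_pos rfl] at h
  exact h

/-- … and vanishes if its degree is none of the summands' degrees. [folklore] -/
theorem eq_zero_of_hom_of_eq_sum_hom {ι : Type*} (s : Finset ι) (g : ι → L) (d : ι → ℤ)
    (hg : ∀ j ∈ s, β (g j) = single (d j) (g j)) {x : L} (hx : x = ∑ j ∈ s, g j) (e : ℤ)
    (he : ∀ j ∈ s, d j ≠ e) (hxe : β x = single e x) : x = 0 := by
  have h : (β x).coeff e = 0 := by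
    rw [hx, map_sum, Finset.sum_congr rfl hg]
    exact coeff_sum_single_of_notMem s g d e he
  rwa [coeff_of_hom hxe, if_pos rfl] at h

end Hom

/-! ## Counit: the decomposition into components -/

section Counit

variable (β : L →+* L[T;T⁻¹]) (hε : ∀ ℓ : L, LaurentPolynomial.eval₂ (RingHom.id L) 1 (β ℓ) = ℓ)
include hε

/-- **Decomposition**: `ℓ` is the sum of its components `(β ℓ)ᵢ`. [folklore] -/
theorem sum_coeff_eq (ℓ : L) : ∑ i ∈ (β ℓ).coeff.support, (β ℓ).coeff i = ℓ := by
  rw [← eval₂_one_eq_sum]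
  exact hε ℓ

/-- A coaction with counit is injective. [folklore] -/
theorem injective_of_counit : Function.Injective β := fun a b h => by
  rw [← hε a, ← hε b, h]

end Counit

/-! ## Counit and coassociativity from generators -/

section Ext

variable {k : Type} [Field k] [Algebra k L] (β : L →+* L[T;T⁻¹]) (G : Set L)
  (hext : ∀ (X : Type) [CommRing X] (φ ψ : L →+* X),
    (∀ c : k, φ (algebraMap k L c) = ψ (algebraMap k L c)) → (∀ g ∈ G, φ g = ψ g) → φ = ψ)
  (hG : ∀ g ∈ G, ∃ d : ℤ, β g = single d g)
  (hk : ∀ c : k, β (algebraMap k L c) = LaurentPolynomial.C (algebraMap k L c))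

/-- There is a unit `W` of `L[T;T⁻¹][T;T⁻¹]` with `Wⁿ = C(Tⁿ) · Tⁿ` for all `n : ℤ` ("`T₁ T₂`"). [folklore] -/
theorem exists_unit_CT_mul_T : ∃ W : (L[T;T⁻¹][T;T⁻¹])ˣ,
    ∀ n : ℤ, ((W ^ n : (L[T;T⁻¹][T;T⁻¹])ˣ) : L[T;T⁻¹][T;T⁻¹]) = LaurentPolynomial.C (T n) * T n := by
  have hmul : ∀ a b : ℤ, (LaurentPolynomial.C (T a) * T a : L[T;T⁻¹][T;T⁻¹]) * (LaurentPolynomial.C (T b) * T b) =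
      LaurentPolynomial.C (T (a + b)) * T (a + b) := fun a b => by
    rw [T_add, T_add, map_mul]; ring
  have hone : (LaurentPolynomial.C (T 0) * T 0 : L[T;T⁻¹][T;T⁻¹]) = 1 := by
    rw [T_zero, T_zero, map_one, mul_one]
  let W : (L[T;T⁻¹][T;T⁻¹])ˣ :=
    ⟨LaurentPolynomial.C (T 1) * T 1, LaurentPolynomial.C (T (-1)) * T (-1),
      by rw [hmul, add_neg_cancel, hone], by rw [hmul, neg_add_cancel, hone]⟩
  refine ⟨W, fun n => ?_⟩
  induction n using Int.induction_on with
  | zero => rw [zpow_zero, Units.val_one, hone]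
  | succ n ih => rw [zpow_add_one, Units.val_mul, ih]; exact hmul _ _
  | pred n ih =>
    rw [zpow_sub_one, Units.val_mul, ih, sub_eq_add_neg]
    exact hmul _ _

/-- Laurent evaluation at `W = T₁T₂` of a monomial: `single j a ↦ single j (single j a)`. [folklore] -/
theorem eval₂_CC_single (W : (L[T;T⁻¹][T;T⁻¹])ˣ)
    (hW : ∀ n : ℤ, ((W ^ n : (L[T;T⁻¹][T;T⁻¹])ˣ) : L[T;T⁻¹][T;T⁻¹]) = LaurentPolynomial.C (T n) * T n)
    (j : ℤ) (a : L) :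
    LaurentPolynomial.eval₂ (LaurentPolynomial.C.comp LaurentPolynomial.C) W (single j a) =
      single j (single j a) := by
  rw [single_eq_C_mul_T, eval₂_C_mul_T, hW, RingHom.comp_apply, ← mul_assoc, ← map_mul,
    ← single_eq_C_mul_T, ← single_eq_C_mul_T]

include hext hG hk

/-- **Counit from generators**: if ring maps out of `L` are determined on `k` and on homogeneous generators
`G`, then `ε ∘ β = id`. [folklore] -/
theorem counit_of_ext (ℓ : L) : LaurentPolynomial.eval₂ (RingHom.id L) 1 (β ℓ) = ℓ := by
  have h := hext L ((LaurentPolynomial.eval₂ (RingHom.id L) 1).comp β) (RingHom.id L)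
    (fun c => by rw [RingHom.comp_apply, hk, eval₂_C, RingHom.id_apply])
    (fun g hg => by
      obtain ⟨d, hd⟩ := hG g hg
      rw [RingHom.comp_apply, hd, single_eq_C_mul_T, eval₂_C_mul_T, one_zpow, Units.val_one, mul_one,
        RingHom.id_apply])
  exact RingHom.congr_fun h ℓ

/-- **Coassociativity from generators** ("components are homogeneous"): under the same hypothesis,
`β ((β ℓ)ᵢ) = single i ((β ℓ)ᵢ)` for every `ℓ` and `i` — both sides are the `i`-th coefficient of the two ring
maps `(β ⊗ id) ∘ β` and `(id ⊗ Δ) ∘ β : L → L[T;T⁻¹][T;T⁻¹]`, which agree on generators. [folklore] -/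
theorem coassoc_of_ext (ℓ : L) (i : ℤ) : β ((β ℓ).coeff i) = single i ((β ℓ).coeff i) := by
  classical
  obtain ⟨W, hW⟩ := exists_unit_CT_mul_T (L := L)
  have hΦ : (mapRingHom ℤ β).comp β =
      (LaurentPolynomial.eval₂ (LaurentPolynomial.C.comp LaurentPolynomial.C) W).comp β := by
    refine hext _ _ _ (fun c => ?_) (fun g hg => ?_)
    · rw [RingHom.comp_apply, RingHom.comp_apply, hk, eval₂_C, RingHom.comp_apply, ← single_eq_C,
        mapRingHom_single, hk, ← single_eq_C, ← single_eq_C]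
    · obtain ⟨d, hd⟩ := hG g hg
      rw [RingHom.comp_apply, RingHom.comp_apply, hd, mapRingHom_single, hd, eval₂_CC_single W hW]
  have h1 : ((mapRingHom ℤ β).comp β ℓ).coeff i = β ((β ℓ).coeff i) := by
    rw [RingHom.comp_apply, coeff_mapRingHom]
  have h2 : ((LaurentPolynomial.eval₂ (LaurentPolynomial.C.comp LaurentPolynomial.C) W).comp β ℓ).coeff i =
      single i ((β ℓ).coeff i) := by
    rw [RingHom.comp_apply]
    conv_lhs => rw [← sum_coeff_single (β ℓ), Finsupp.sum, map_sum]
    simp only [eval₂_CC_single W hW]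
    by_cases hi : i ∈ (β ℓ).coeff.support
    · exact coeff_sum_single (L := L[T;T⁻¹]) (β ℓ).coeff.support (fun j => single j ((β ℓ).coeff j)) id
        (fun _ _ _ _ h => h) i hi
    · rw [Finsupp.notMem_support_iff.mp hi, single_zero]
      exact coeff_sum_single_of_notMem (L := L[T;T⁻¹]) _ _ id i fun j hj h => hi (h ▸ hj)
  rw [← h1, hΦ, h2]

end Ext

end Summit.ResolutionOfSingularities.ResolutionOfSingularities.Theorems.FInjectiveMacaulayfication.LaurentCoaction

end
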